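import Mathlib
import HarnessLib

/-!
# Catalan box family — the parity subgroup of Whipple's group meets every Π-class (certified, finite group theory)

HONEST FRAMING: systematic search; no irrationality claim unless certified.  Cell `pub-zeta5`, seat `fam-catalan`
(`run/shared/lean/pub/pub-zeta5/families/catalan/FAMILY.md`, item K0 / finding F9).  Nothing in this file concerns
irrationality: it is a statement about a permutation group on ten letters, proved inside the kernel (`decide`, no
`native_decide`) plus a closure argument.

Zudilin [arXiv:math/0210423, §3, display (22)] lets Whipple's group `𝔊 ⊂ S₁₀` of the `₃F₂(1)`-transformations act on the
ten parameters `c = (c₀₀, c₁₁, c₁₂, c₁₃, c₂₁, c₂₂, c₂₃, c₃₁, c₃₂, c₃₃)` of the double integral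
`H(c) = ∫∫ x^{c₂₁}(1−x)^{c₂₂}y^{c₃₁}(1−y)^{c₃₃}(1−xy)^{−c₁₁−1} dx dy` by the permutations
`𝔞₁ = (c₁₁ c₃₁)(c₁₂ c₃₂)(c₁₃ c₃₃)`, `𝔞₂ = (c₂₁ c₃₁)(c₂₂ c₃₂)(c₂₃ c₃₃)`, `𝔟 = (c₁₂ c₁₃)(c₂₂ c₂₃)(c₃₂ c₃₃)`,
`𝔥 = (c₀₀ c₂₂)(c₁₁ c₃₃)(c₁₃ c₃₁)`, and [ibid., Theorem 3 (i)] `H(c)/Π(c)` is `𝔊`-stable, `Π(c)` being a product of Gamma factors at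
the five "Π-slots" `c₀₀, c₂₁, c₂₂, c₃₃, c₃₁`.  Hence the transport factor `Π(σc)/Π(c)` attached to `σ ∈ 𝔊` depends only on WHICH
five slots `σ` moves onto the Π-slots, i.e. on the class `σ⁻¹{Π-slots}`; Rhin–Viola [Acta Arith. 77 (1996) 23–56, p. 38] count twelve
such classes for the same group in their coordinates ("since `|Φ| = 120` and `|T| = 10`, there are 12 left cosets of `T` in `Φ`",
characterised by the factorials `h!i!j!k!l!`).  The Catalan family (Zudilin's parity condition (21): `c₂₂, c₃₁, c₁₁, c₂₃ ∈ ℤ`, the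
other six in `ℤ + ½`) is mapped into itself exactly by the PARITY SUBGROUP
`𝔊₀ = {σ ∈ 𝔊 : σ{c₁₁, c₂₂, c₂₃, c₃₁} = {c₁₁, c₂₂, c₂₃, c₃₁}}` (order 24; FAMILY.md F4).

THIS FILE PROVES (slots indexed by `Fin 10` in the order `00,11,12,13,21,22,23,31,32,33 ↦ 0,…,9`; a class is recorded by its
indicator function `Fin 10 → Bool`; checker + soundness pattern, everything by `decide` in the kernel):
* `cls` — twelve explicit classes, `cls 0` = the Π-slots; `stab` — the subgroup of permutations under which the preimage AND the
  image of every listed class is again a listed class; the four generators lie in `stab` (`decide`), hence `whipple ≤ stab`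
  (`Subgroup.closure_le`): for EVERY `σ ∈ 𝔊` the class `σ⁻¹{Π-slots}` is one of the twelve (`class_of_mem`);
* `word` — twelve explicit words in the generators, each mapping the integer slots `{c₁₁,c₂₂,c₂₃,c₃₁}` onto themselves (so lying in
  `𝔊₀`) with `word j ⁻¹{Π-slots} = cls j` (`decide`);
* **`paritySubgroup_meets_every_class`** — for every `σ ∈ 𝔊` there is `τ ∈ 𝔊` preserving the integer slots with
  `τ⁻¹{Π-slots} = σ⁻¹{Π-slots}` (stated pointwise: `τ i` is a Π-slot iff `σ i` is).  Consequently `{Π(σc) : σ ∈ 𝔊} = {Π(τc) : τ ∈ 𝔊₀}`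
  for every parameter set `c`: restricting the Rhin–Viola transport mechanism to the parity-preserving permutations — the only ones
  that keep the Catalan family inside itself — loses none of the twelve factorial transformation formulae.  (FAMILY.md F9 checks the
  same numerically: zero excess saving of the full group over `𝔊₀` at 4 591 exact `(n,p)` pairs and 2 239 directions.)
The group order `|𝔊| = 120` (Whipple 1925) is neither needed nor certified here.
-/

namespace Summit.KontsevichZagierPeriods.Zeta5Search.CatalanParityGroup

open Equiv

/-! ### The generators (slots `00,11,12,13,21,22,23,31,32,33` ↦ `0,…,9`) -/

/-- `𝔞₁ = (c₁₁ c₃₁)(c₁₂ c₃₂)(c₁₃ c₃₃)`. [cite: Zudilin2002CatalanRemarks, §3 eq. (22) (arXiv:math/0210423)] -/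
def a1 : Perm (Fin 10) := swap 1 7 * swap 2 8 * swap 3 9
/-- `𝔞₂ = (c₂₁ c₃₁)(c₂₂ c₃₂)(c₂₃ c₃₃)`. [cite: Zudilin2002CatalanRemarks, §3 eq. (22) (arXiv:math/0210423)] -/
def a2 : Perm (Fin 10) := swap 4 7 * swap 5 8 * swap 6 9
/-- `𝔟 = (c₁₂ c₁₃)(c₂₂ c₂₃)(c₃₂ c₃₃)`. [cite: Zudilin2002CatalanRemarks, §3 eq. (22) (arXiv:math/0210423)] -/
def b : Perm (Fin 10) := swap 2 3 * swap 5 6 * swap 8 9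
/-- `𝔥 = (c₀₀ c₂₂)(c₁₁ c₃₃)(c₁₃ c₃₁)`. [cite: Zudilin2002CatalanRemarks, §3 eq. (22) (arXiv:math/0210423)] -/
def h : Perm (Fin 10) := swap 0 5 * swap 1 9 * swap 3 7

/-- The generating set `{𝔞₁, 𝔞₂, 𝔟, 𝔥}`. -/
def gens : Set (Perm (Fin 10)) := {a1, a2, b, h}

/-- Whipple's group `𝔊 = ⟨𝔞₁, 𝔞₂, 𝔟, 𝔥⟩ ≤ S₁₀` (as a subgroup of `Perm (Fin 10)`). -/
def whipple : Subgroup (Perm (Fin 10)) := Subgroup.closure gens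

/-- Indicator of the Π-slots `c₀₀, c₂₁, c₂₂, c₃₁, c₃₃` (indices `0, 4, 5, 7, 9`): the Gamma factors of `Π(c)`. -/
def piB : Fin 10 → Bool := ![true, false, false, false, true, true, false, true, false, true]

/-- Indicator of the integer slots `c₁₁, c₂₂, c₂₃, c₃₁` (indices `1, 5, 6, 7`) of the Catalan family (Zudilin's condition (21)). -/
def intB : Fin 10 → Bool := ![false, true, false, false, false, true, true, true, false, false]

/-- The twelve classes `σ⁻¹{Π-slots}` (`σ ∈ 𝔊`), as indicator functions; `cls 0 = piB`. In slot names: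
`{00,21,22,31,33}, {00,11,13,21,22}, {00,21,23,31,32}, {00,11,12,21,23}, {13,22,31,32,33}, {11,12,13,22,33},
{12,23,31,32,33}, {13,21,22,23,32}, {00,11,13,31,32}, {11,12,13,23,32}, {12,21,22,23,33}, {00,11,12,31,33}`. -/
def cls : Fin 12 → Fin 10 → Bool
  | ⟨0, _⟩ => ![true, false, false, false, true, true, false, true, false, true]
  | ⟨1, _⟩ => ![true, true, false, true, true, true, false, false, false, false]
  | ⟨2, _⟩ => ![true, false, false, false, true, false, true, true, true, false]
  | ⟨3, _⟩ => ![true, true, true, false, true, false, true, false, false, false]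
  | ⟨4, _⟩ => ![false, false, false, true, false, true, false, true, true, true]
  | ⟨5, _⟩ => ![false, true, true, true, false, true, false, false, false, true]
  | ⟨6, _⟩ => ![false, false, true, false, false, false, true, true, true, true]
  | ⟨7, _⟩ => ![false, false, false, true, true, true, true, false, true, false]
  | ⟨8, _⟩ => ![true, true, false, true, false, false, false, true, true, false]
  | ⟨9, _⟩ => ![false, true, true, true, false, false, true, false, true, false]
  | ⟨10, _⟩ => ![false, false, true, false, true, true, true, false, false, true]
  | ⟨11, _⟩ => ![true, true, true, false, false, false, false, true, false, true]

/-- `cls 0` is the Π-class itself. -/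
theorem cls_zero : cls 0 = piB := rfl

/-- Boolean checker (kernel-evaluable): "the preimage of every listed class under `f` is a listed class",
i.e. `∀ j ∃ j', cls j ∘ f = cls j'`. -/
def preservesB (f : Fin 10 → Fin 10) : Bool :=
  decide (∀ j : Fin 12, ∃ j' : Fin 12, ∀ i : Fin 10, cls j (f i) = cls j' i)

/-- `preservesB f` unfolds to: `f` maps Π-slots to Π-slots. -/
theorem preservesB_iff (f : Fin 10 → Fin 10) :
    preservesB f = true ↔ ∀ j : Fin 12, ∃ j' : Fin 12, ∀ i : Fin 10, cls j (f i) = cls j' i := by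
  unfold preservesB
  exact decide_eq_true_iff

/-- `preservesB` is closed under composition. -/
theorem preservesB_comp {f g : Fin 10 → Fin 10} (hf : preservesB f = true) (hg : preservesB g = true) :
    preservesB (f ∘ g) = true := by
  rw [preservesB_iff] at hf hg ⊢
  intro j
  obtain ⟨j₁, h₁⟩ := hf j
  obtain ⟨j₂, h₂⟩ := hg j₁
  exact ⟨j₂, fun i => by simp only [Function.comp_apply]; rw [h₁, h₂]⟩

/-! ### The twelve classes are permuted by Whipple's group -/

/-- The subgroup of permutations `σ` such that both `σ` and `σ⁻¹` pull listed classes back to listed classes. -/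
def stab : Subgroup (Perm (Fin 10)) where
  carrier := {σ | preservesB ⇑σ = true ∧ preservesB ⇑σ.symm = true}
  one_mem' := by
    show preservesB ⇑(1 : Perm (Fin 10)) = true ∧ preservesB ⇑(1 : Perm (Fin 10)).symm = true
    decide
  mul_mem' := by
    intro σ τ hσ hτ
    have e₁ : (⇑(σ * τ) : Fin 10 → Fin 10) = ⇑σ ∘ ⇑τ := Equiv.Perm.coe_mul σ τ
    have e₂ : (⇑(σ * τ).symm : Fin 10 → Fin 10) = ⇑τ.symm ∘ ⇑σ.symm := by funext i; rfl
    refine ⟨?_, ?_⟩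
    · rw [e₁]; exact preservesB_comp hσ.1 hτ.1
    · rw [e₂]; exact preservesB_comp hτ.2 hσ.2
  inv_mem' := by
    intro σ hσ
    exact ⟨hσ.2, hσ.1⟩

set_option maxRecDepth 20000 in
/-- `𝔞₁` permutes the twelve classes. -/
theorem a1_mem_stab : a1 ∈ stab := by
  show preservesB ⇑a1 = true ∧ preservesB ⇑a1.symm = true
  decide
set_option maxRecDepth 20000 in
/-- `𝔞₂` permutes the twelve classes. -/
theorem a2_mem_stab : a2 ∈ stab := by
  show preservesB ⇑a2 = true ∧ preservesB ⇑a2.symm = true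
  decide
set_option maxRecDepth 20000 in
/-- `𝔟` permutes the twelve classes. -/
theorem b_mem_stab : b ∈ stab := by
  show preservesB ⇑b = true ∧ preservesB ⇑b.symm = true
  decide
set_option maxRecDepth 20000 in
/-- `𝔥` permutes the twelve classes. -/
theorem h_mem_stab : h ∈ stab := by
  show preservesB ⇑h = true ∧ preservesB ⇑h.symm = true
  decide

/-- Every element of Whipple's group permutes the twelve classes. -/
theorem whipple_le_stab : whipple ≤ stab := by
  rw [whipple, Subgroup.closure_le]
  intro g hg
  simp only [gens, Set.mem_insert_iff, Set.mem_singleton_iff] at hg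
  rcases hg with rfl | rfl | rfl | rfl
  · exact a1_mem_stab
  · exact a2_mem_stab
  · exact b_mem_stab
  · exact h_mem_stab

/-- For every `σ ∈ 𝔊`, the class `σ⁻¹{Π-slots}` (indicator `piB ∘ σ`) is one of the twelve. -/
theorem class_of_mem (σ : Perm (Fin 10)) (hσ : σ ∈ whipple) : ∃ j : Fin 12, ∀ i, piB (σ i) = cls j i :=
  (preservesB_iff _).1 (whipple_le_stab hσ).1 0

/-! ### Twelve parity-preserving words exhaust the classes -/

/-- Twelve explicit words in the generators (`𝔠 := 𝔞₂𝔥𝔞₂`; FAMILY.md F4: `𝔊₀ = ⟨𝔞₁, 𝔟, 𝔠⟩`):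
`1, 𝔞₁, 𝔟, 𝔟𝔞₁, 𝔠, 𝔠𝔞₁, 𝔞₂𝔥𝔟𝔞₂, 𝔞₁𝔠, 𝔟𝔠, 𝔞₂𝔥𝔟𝔞₂𝔞₁, 𝔞₁𝔠𝔞₁, 𝔟𝔠𝔞₁`. -/
def word : Fin 12 → Perm (Fin 10)
  | ⟨0, _⟩ => 1
  | ⟨1, _⟩ => a1
  | ⟨2, _⟩ => b
  | ⟨3, _⟩ => b * a1
  | ⟨4, _⟩ => a2 * h * a2
  | ⟨5, _⟩ => a2 * h * a2 * a1
  | ⟨6, _⟩ => a2 * h * b * a2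
  | ⟨7, _⟩ => a1 * (a2 * h * a2)
  | ⟨8, _⟩ => b * (a2 * h * a2)
  | ⟨9, _⟩ => a2 * h * b * a2 * a1
  | ⟨10, _⟩ => a1 * (a2 * h * a2) * a1
  | ⟨11, _⟩ => b * (a2 * h * a2) * a1

/-- `𝔞₁ ∈ 𝔊`. -/
theorem a1_mem : a1 ∈ whipple := Subgroup.subset_closure (by simp [gens])
/-- `𝔞₂ ∈ 𝔊`. -/
theorem a2_mem : a2 ∈ whipple := Subgroup.subset_closure (by simp [gens])
/-- `𝔟 ∈ 𝔊`. -/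
theorem b_mem : b ∈ whipple := Subgroup.subset_closure (by simp [gens])
/-- `𝔥 ∈ 𝔊`. -/
theorem h_mem : h ∈ whipple := Subgroup.subset_closure (by simp [gens])

/-- `𝔞₂𝔥𝔞₂ ∈ 𝔊`. -/
theorem c_mem : a2 * h * a2 ∈ whipple := Subgroup.mul_mem _ (Subgroup.mul_mem _ a2_mem h_mem) a2_mem

/-- Each word lies in Whipple's group. -/
theorem word_mem : ∀ j : Fin 12, word j ∈ whipple
  | ⟨0, _⟩ => Subgroup.one_mem _
  | ⟨1, _⟩ => a1_mem
  | ⟨2, _⟩ => b_mem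
  | ⟨3, _⟩ => Subgroup.mul_mem _ b_mem a1_mem
  | ⟨4, _⟩ => c_mem
  | ⟨5, _⟩ => Subgroup.mul_mem _ c_mem a1_mem
  | ⟨6, _⟩ => Subgroup.mul_mem _ (Subgroup.mul_mem _ (Subgroup.mul_mem _ a2_mem h_mem) b_mem) a2_mem
  | ⟨7, _⟩ => Subgroup.mul_mem _ a1_mem c_mem
  | ⟨8, _⟩ => Subgroup.mul_mem _ b_mem c_mem
  | ⟨9, _⟩ => Subgroup.mul_mem _ (Subgroup.mul_mem _ (Subgroup.mul_mem _ (Subgroup.mul_mem _ a2_mem h_mem) b_mem) a2_mem) a1_mem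
  | ⟨10, _⟩ => Subgroup.mul_mem _ (Subgroup.mul_mem _ a1_mem c_mem) a1_mem
  | ⟨11, _⟩ => Subgroup.mul_mem _ (Subgroup.mul_mem _ b_mem c_mem) a1_mem
  | ⟨n + 12, hn⟩ => absurd hn (by omega)

set_option maxRecDepth 20000 in
/-- Each word maps the integer slots `{c₁₁, c₂₂, c₂₃, c₃₁}` into (hence onto) themselves: it lies in the parity subgroup `𝔊₀`. -/
theorem word_preserves_int : ∀ j : Fin 12, ∀ i : Fin 10, intB (word j i) = intB i := by
  decide

set_option maxRecDepth 20000 in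
/-- `word j ⁻¹{Π-slots} = cls j`. -/
theorem word_class : ∀ j : Fin 12, ∀ i : Fin 10, piB (word j i) = cls j i := by
  decide

/-! ### The theorem -/

/-- **K0 / F9.  The parity subgroup meets every Π-class of Whipple's group:** for every `σ ∈ 𝔊 = ⟨𝔞₁,𝔞₂,𝔟,𝔥⟩` there is `τ ∈ 𝔊`
which maps the integer slots `{c₁₁,c₂₂,c₂₃,c₃₁}` onto themselves (so `τ` keeps Zudilin's parity condition (21), i.e. maps the Catalan
family into itself) and has the same class: `τ i` is a Π-slot iff `σ i` is, i.e. `τ⁻¹{c₀₀,c₂₁,c₂₂,c₃₃,c₃₁} = σ⁻¹{c₀₀,c₂₁,c₂₂,c₃₃,c₃₁}`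
— hence the same transport factor `Π(τc)/Π(c) = Π(σc)/Π(c)` for every parameter set `c`.  Pure finite group theory; nothing about
irrationality. -/
theorem paritySubgroup_meets_every_class (σ : Perm (Fin 10)) (hσ : σ ∈ whipple) :
    ∃ τ ∈ whipple, (∀ i, intB (τ i) = intB i) ∧ (∀ i, piB (τ i) = piB (σ i)) := by
  obtain ⟨j, hj⟩ := class_of_mem σ hσ
  exact ⟨word j, word_mem j, word_preserves_int j, fun i => by rw [word_class j i, hj i]⟩

/-- The same with the slot sets as `Finset`s: `piSlots = {0,4,5,7,9}` (`c₀₀,c₂₁,c₂₂,c₃₁,c₃₃`), `intSlots = {1,5,6,7}`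
(`c₁₁,c₂₂,c₂₃,c₃₁`). -/
def piSlots : Finset (Fin 10) := {0, 4, 5, 7, 9}
/-- The integer slots `c₁₁, c₂₂, c₂₃, c₃₁` as a `Finset`. -/
def intSlots : Finset (Fin 10) := {1, 5, 6, 7}

/-- `piSlots` is the support of `piB`. -/
theorem mem_piSlots_iff : ∀ i : Fin 10, i ∈ piSlots ↔ piB i = true := by decide
/-- `intSlots` is the support of `intB`. -/
theorem mem_intSlots_iff : ∀ i : Fin 10, i ∈ intSlots ↔ intB i = true := by decide

/-- **K0 / F9, `Finset` form:** for every `σ` in Whipple's group there is `τ` in Whipple's group with `τ(intSlots) ⊆ intSlots`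
(pointwise: `τ i ∈ intSlots ↔ i ∈ intSlots`) and `τ⁻¹(piSlots) = σ⁻¹(piSlots)` (pointwise: `τ i ∈ piSlots ↔ σ i ∈ piSlots`). -/
theorem paritySubgroup_meets_every_class' (σ : Perm (Fin 10)) (hσ : σ ∈ whipple) :
    ∃ τ ∈ whipple, (∀ i, τ i ∈ intSlots ↔ i ∈ intSlots) ∧ (∀ i, τ i ∈ piSlots ↔ σ i ∈ piSlots) := by
  obtain ⟨τ, hτ, hint, hpi⟩ := paritySubgroup_meets_every_class σ hσ
  refine ⟨τ, hτ, fun i => ?_, fun i => ?_⟩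
  · rw [mem_intSlots_iff, mem_intSlots_iff, hint i]
  · rw [mem_piSlots_iff, mem_piSlots_iff, hpi i]

end Summit.KontsevichZagierPeriods.Zeta5Search.CatalanParityGroup
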